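import Summits.BirchSwinnertonDyer.BirchSwinnertonDyer.Theorems.ManinLocalTwoThreeManinPrimeToThreeOfReducibleOfCuspidalKummer
import Summits.BirchSwinnertonDyer.BirchSwinnertonDyer.Theorems.ManinLocalTwoThreeCubeLawNoBlindSplit
import Summits.BirchSwinnertonDyer.BirchSwinnertonDyer.Theorems.ManinLocalTwoThreeGammaOneKatoRoadThree
import Summits.BirchSwinnertonDyer.BirchSwinnertonDyer.Theorems.ManinLocalTwoThreeManinPrimeToThreeAtNineOfOrdJLeZero
import Summits.BirchSwinnertonDyer.Rank1Residual.ManinAdditive.CuspidalKummerCubeNoBlindLaws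
import HarnessLib

/-!
# C3 `ManinPrimeToThreeAtNine` AT ONE DATUM and READ ON p2's C3 CORE — the LEAD's option (a) of Q-p1-g13-1 (route `ManinLocalTwoThree`, cell bsd-f2-manin;
# crux C3 stmt-BirchSwinnertonDyer-22968; LEAD seat p1 gen 13)

THE POINT.  For ONE lattice-optimal `X₀(N)`-datum `(W, D)` with `9 ∣ N`, `3 ∤ c` follows from inputs AT THE DATUM: irreducible `W[3]` — F₃ (polar, or the
KP stub F₃♮ via `polar_of_kp`) through the `X₁(N)`-optimal curve (the Γ₁ lever at 3, `katoManinPrimeToThree_of_polar_of_exists_gamma1`, p705627; NO nine-shift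
chain) + Stevens' datum (hex); a rational short 3-torsion point — E-an-57 (cube representative), LAW₃♮ (an exponent `≢ 0 (mod 3)` at a non-blind point) and
NB₃ (no blind short 3-torsion on an optimal curve) AT THE DATUM + the certificate theorem E-an-55 `ManinThreeKummerCube_holds`; no short 3-torsion — the PLAIN
residual RES₃ AT THE DATUM (`not_three_dvd_maninConstant_of_datumLaws₃`).  Every input being at the datum's own curve, p2 g15's three CORE binders
(`v₃(j) < 1`, Kodaira type at 3 not `Iₙ*`/`I₀*`…, `W ⊗ (−3)` additive at 3 — `maninPrimeToThreeAtNine_of_core`, p706475) thread for free: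
**`maninPrimeToThreeAtNine_of_katoFact_of_coreDatumLaws`** = the ROUTE DECL BY NAME from {F₃♮, hex} printed + {E-an-57, LAW₃♮, NB₃, RES₃} read on the C3 core.
TRADE-OFF vs the skeleton of record v18 (-imc): v18's residual is RES₃♭ (orbit-minimal, coprime-isolated; reached through the twist-orbit descent, whose
partners are given up to ISOGENY — the `j`-binder does not transport there without an isogeny-invariance fact for potential supersingularity); here the
residual is the PLAIN RES₃ but read on the core only.  Incomparable laws; the planner-of-record chooses.  Not registered; candidate line text is the obvious one.

HONEST FRAMING.  CONDITIONAL reduction; the four laws are OPEN; F₃♮ / hex statement-only.  C3, Manin's conjecture and BSD are NOT proved.  No definitions, no sorry.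
-/

set_option autoImplicit false
-- lint-debt: the directory name repeats the summit name (sibling precedent `ManinLocalTwoThreeGammaOneKatoRoad.lean`)
set_option linter.dupNamespace false

noncomputable section

open scoped Classical MatrixGroups ModularForm NumberField
open PowerSeries CongruenceSubgroup IsDedekindDomain IsDedekindDomain.HeightOneSpectrum Rat.HeightOneSpectrum
open WeierstrassCurve Literature.NumberTheory.EllipticCurves Literature.NumberTheory.EllipticCurves.ModularForms
open Summit.BirchSwinnertonDyer.Rank1Residual.ManinAdditive
open Summit.BirchSwinnertonDyer.Rank1Residual.ManinAdditive.CuspidalKummer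
open Summit.BirchSwinnertonDyer.Rank1Residual.ManinAdditive.CuspidalKummerThree

namespace Summit.BirchSwinnertonDyer.BirchSwinnertonDyer.Theorems.ManinLocalTwoThree

/-! ## §1 C3 AT ONE DATUM -/

/-- **C3 at one datum.**  `W` globally minimal, `D` a lattice-optimal `X₀(N)`-datum, `9 ∣ N`: `3 ∤ c` from F₃ (polar) + hex on the irreducible locus (Γ₁ road
at 3), E-an-57 / LAW₃♮ / NB₃ AT THE DATUM on a rational short 3-torsion point (+ E-an-55 theorem), and the plain residual RES₃ AT THE DATUM otherwise.
CONDITIONAL; nothing about BSD is proved. [cite: Kato2004Asterisque, Thm. 12.6 (2) (p. 222) (F₃)] [cite: Stevens1989, §2 (hex)] -/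
theorem not_three_dvd_maninConstant_of_datumLaws₃
    (hF : kato_neron_isIntegral_twistedSymbolSum_of_additive_three_polar) (hex : exists_optimal_gamma1ParametrizationData)
    (W : WeierstrassCurve ℚ) [W.IsElliptic] [W.IsGloballyMinimal] {N : ℕ} [NeZero N] (D : ModularParametrizationData W N)
    (hopt : ∀ z ∈ D.L.lattice, ∃ w ∈ periodLattice D.f, z = D.c * w) (h9 : 3 ^ 2 ∣ N)
    (h57W : ∀ (a : ℕ → ℤ), (∀ n, (a n : ℂ) = cuspCoeff D.f n) →
      ∀ X₀ Y₀ : ℚ, IsShortThreeTorsion W D.c X₀ Y₀ → ∀ z : ℚ⟦X⟧, IsParamGerm W D.c a z →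
      ∃ (r : ℕ → ℤ) (g A B : ℤ⟦X⟧), IsCuspidalKummerCubeRep N (kummerCubeSeries W D.c X₀ Y₀ z) r g A B)
    (hLawW : ∀ (a : ℕ → ℤ), (∀ n, (a n : ℂ) = cuspCoeff D.f n) →
      ∀ X₀ Y₀ : ℚ, IsShortThreeTorsion W D.c X₀ Y₀ →
      ¬ IsThreeAdicFracCube (kummerCubeSeries W 1 (X₀ / (D.c : ℚ) ^ 2) (Y₀ / (D.c : ℚ) ^ 3) X) →
      ∀ z : ℚ⟦X⟧, IsParamGerm W D.c a z →
      ∀ (r : ℕ → ℤ) (g A B : ℤ⟦X⟧), IsCuspidalKummerCubeRep N (kummerCubeSeries W D.c X₀ Y₀ z) r g A B →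
      ∃ δ ∈ N.divisors, ¬ (3 : ℤ) ∣ r δ)
    (hNBW : ∀ X₁ Y₁ : ℚ, IsShortThreeTorsion W 1 X₁ Y₁ → ¬ IsThreeAdicFracCube (kummerCubeSeries W 1 X₁ Y₁ X))
    (hResW : ¬ W.HasIrreducibleModPGaloisRep 3 → (∀ X₀ Y₀ : ℚ, ¬ IsShortThreeTorsion W D.c X₀ Y₀) → ¬ (3 : ℤ) ∣ D.c) :
    ¬ (3 : ℤ) ∣ D.maninConstant := by
  by_cases hirr : W.HasIrreducibleModPGaloisRep 3
  · exact katoManinPrimeToThree_of_polar_of_exists_gamma1 hF hex W D hopt h9 hirr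
  have h9' : 9 ∣ N := by norm_num at h9; exact h9
  by_cases hT : ∃ X₀ Y₀ : ℚ, IsShortThreeTorsion W D.c X₀ Y₀
  · obtain ⟨X₀, Y₀, hT⟩ := hT
    have hc0 : D.c ≠ 0 := D.maninConstant_ne_zero_holds
    set a : ℕ → ℤ := fun n => W.LFunction n with ha_def
    have ha : ∀ n, (a n : ℂ) = cuspCoeff D.f n := fun n => (D.isNewformOf.2 n).symm
    obtain ⟨z, hz⟩ := exists_isParamGerm W D.c a
    obtain ⟨r, g, A, B, hrep⟩ := h57W a ha X₀ Y₀ hT z hz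
    have hT1 : IsShortThreeTorsion W 1 (X₀ / (D.c : ℚ) ^ 2) (Y₀ / (D.c : ℚ) ^ 3) :=
      (isShortThreeTorsion_iff_intrinsic W hc0 X₀ Y₀).mp hT
    have hδ : ∃ δ ∈ N.divisors, ¬ (3 : ℤ) ∣ r δ := hLawW a ha X₀ Y₀ hT (hNBW _ _ hT1) z hz r g A B hrep
    exact maninPrimeToThreeOfEtaExponent_of_maninThreeKummerCube ManinThreeKummerCube_holds W D a ha h9' X₀ Y₀ hT z hz r g A B hrep hδ
  · push Not at hT
    exact hResW hirr hT

/-- The same with v18's KP stub F₃♮ (`polar_of_kp`). [cite: KostersPannekoek2017, Thm. 1, §3.3.1] -/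
theorem not_three_dvd_maninConstant_of_datumLaws₃_kp
    (hKP : kato_neron_isIntegral_twistedSymbolSum_of_additive_three_kp) (hex : exists_optimal_gamma1ParametrizationData)
    (W : WeierstrassCurve ℚ) [W.IsElliptic] [W.IsGloballyMinimal] {N : ℕ} [NeZero N] (D : ModularParametrizationData W N)
    (hopt : ∀ z ∈ D.L.lattice, ∃ w ∈ periodLattice D.f, z = D.c * w) (h9 : 3 ^ 2 ∣ N)
    (h57W : ∀ (a : ℕ → ℤ), (∀ n, (a n : ℂ) = cuspCoeff D.f n) →
      ∀ X₀ Y₀ : ℚ, IsShortThreeTorsion W D.c X₀ Y₀ → ∀ z : ℚ⟦X⟧, IsParamGerm W D.c a z →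
      ∃ (r : ℕ → ℤ) (g A B : ℤ⟦X⟧), IsCuspidalKummerCubeRep N (kummerCubeSeries W D.c X₀ Y₀ z) r g A B)
    (hLawW : ∀ (a : ℕ → ℤ), (∀ n, (a n : ℂ) = cuspCoeff D.f n) →
      ∀ X₀ Y₀ : ℚ, IsShortThreeTorsion W D.c X₀ Y₀ →
      ¬ IsThreeAdicFracCube (kummerCubeSeries W 1 (X₀ / (D.c : ℚ) ^ 2) (Y₀ / (D.c : ℚ) ^ 3) X) →
      ∀ z : ℚ⟦X⟧, IsParamGerm W D.c a z →
      ∀ (r : ℕ → ℤ) (g A B : ℤ⟦X⟧), IsCuspidalKummerCubeRep N (kummerCubeSeries W D.c X₀ Y₀ z) r g A B →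
      ∃ δ ∈ N.divisors, ¬ (3 : ℤ) ∣ r δ)
    (hNBW : ∀ X₁ Y₁ : ℚ, IsShortThreeTorsion W 1 X₁ Y₁ → ¬ IsThreeAdicFracCube (kummerCubeSeries W 1 X₁ Y₁ X))
    (hResW : ¬ W.HasIrreducibleModPGaloisRep 3 → (∀ X₀ Y₀ : ℚ, ¬ IsShortThreeTorsion W D.c X₀ Y₀) → ¬ (3 : ℤ) ∣ D.c) :
    ¬ (3 : ℤ) ∣ D.maninConstant :=
  not_three_dvd_maninConstant_of_datumLaws₃ (polar_of_kp hKP) hex W D hopt h9 h57W hLawW hNBW hResW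

/-! ## §2 C3 READ ON p2's CORE: the route decl from {F₃♮, hex} + {E-an-57, LAW₃♮, NB₃, RES₃} at core data -/

/-- **THE ROUTE DECL `Theses.ManinLocalTwoThree.ManinPrimeToThreeAtNine` BY NAME from F₃♮, hex and the four laws READ ON THE C3 CORE** ({`9 ∣ N`} ∩
{`v₃(j) < 1`} ∩ {Kodaira type at 3 ∈ {II, III, IV, IV*, III*, II*}} ∩ {`W ⊗ (−3)` additive at 3}): §1 at every core datum, then p2's `maninPrimeToThreeAtNine_of_core`
(the complement of the core is closed by Mazur's fact + modularity: p2 g15 p706475).  CONDITIONAL reduction; C3, Manin's conjecture and BSD are NOT proved.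
[cite: Kato2004Asterisque, Thm. 12.6 (2) (p. 222)] [cite: KostersPannekoek2017, Thm. 1, §3.3.1] [cite: Stevens1989, §2] [cite: Mazur1978, Cor. 4.1] -/
theorem maninPrimeToThreeAtNine_of_katoFact_of_coreDatumLaws
    (hKP : kato_neron_isIntegral_twistedSymbolSum_of_additive_three_kp) (hex : exists_optimal_gamma1ParametrizationData)
    (h57 : ∀ (W : WeierstrassCurve ℚ) [W.IsElliptic] [W.IsGloballyMinimal] {N : ℕ} [NeZero N]
      (D : ModularParametrizationData W N) (a : ℕ → ℤ), (∀ n, (a n : ℂ) = cuspCoeff D.f n) →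
      9 ∣ N → (∀ z ∈ D.L.lattice, ∃ w ∈ periodLattice D.f, z = D.c * w) →
      ((primesEquiv (R := ℤ)).symm ⟨3, Nat.prime_three⟩).valuation ℚ W.j < 1 →
        (W.kodairaSymbolAt ((primesEquiv (R := ℤ)).symm ⟨3, Nat.prime_three⟩) = .II ∨
          W.kodairaSymbolAt ((primesEquiv (R := ℤ)).symm ⟨3, Nat.prime_three⟩) = .III ∨
          W.kodairaSymbolAt ((primesEquiv (R := ℤ)).symm ⟨3, Nat.prime_three⟩) = .IV ∨
          W.kodairaSymbolAt ((primesEquiv (R := ℤ)).symm ⟨3, Nat.prime_three⟩) = .IVstar ∨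
          W.kodairaSymbolAt ((primesEquiv (R := ℤ)).symm ⟨3, Nat.prime_three⟩) = .IIIstar ∨
          W.kodairaSymbolAt ((primesEquiv (R := ℤ)).symm ⟨3, Nat.prime_three⟩) = .IIstar) →
        (haveI := W.isElliptic_quadraticTwist (show ((-3 : ℤ) : ℚ) ≠ 0 by norm_num);
          (W.quadraticTwist ((-3 : ℤ) : ℚ)).HasAdditiveReductionAt ((primesEquiv (R := ℤ)).symm ⟨3, Nat.prime_three⟩)) →
      ∀ X₀ Y₀ : ℚ, IsShortThreeTorsion W D.c X₀ Y₀ →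
      ∀ z : ℚ⟦X⟧, IsParamGerm W D.c a z →
      ∃ (r : ℕ → ℤ) (g A B : ℤ⟦X⟧), IsCuspidalKummerCubeRep N (kummerCubeSeries W D.c X₀ Y₀ z) r g A B)
    (hLaw : ∀ (W : WeierstrassCurve ℚ) [W.IsElliptic] [W.IsGloballyMinimal] {N : ℕ} [NeZero N]
      (D : ModularParametrizationData W N) (a : ℕ → ℤ), (∀ n, (a n : ℂ) = cuspCoeff D.f n) →
      9 ∣ N → (∀ z ∈ D.L.lattice, ∃ w ∈ periodLattice D.f, z = D.c * w) →
      ((primesEquiv (R := ℤ)).symm ⟨3, Nat.prime_three⟩).valuation ℚ W.j < 1 →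
        (W.kodairaSymbolAt ((primesEquiv (R := ℤ)).symm ⟨3, Nat.prime_three⟩) = .II ∨
          W.kodairaSymbolAt ((primesEquiv (R := ℤ)).symm ⟨3, Nat.prime_three⟩) = .III ∨
          W.kodairaSymbolAt ((primesEquiv (R := ℤ)).symm ⟨3, Nat.prime_three⟩) = .IV ∨
          W.kodairaSymbolAt ((primesEquiv (R := ℤ)).symm ⟨3, Nat.prime_three⟩) = .IVstar ∨
          W.kodairaSymbolAt ((primesEquiv (R := ℤ)).symm ⟨3, Nat.prime_three⟩) = .IIIstar ∨
          W.kodairaSymbolAt ((primesEquiv (R := ℤ)).symm ⟨3, Nat.prime_three⟩) = .IIstar) →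
        (haveI := W.isElliptic_quadraticTwist (show ((-3 : ℤ) : ℚ) ≠ 0 by norm_num);
          (W.quadraticTwist ((-3 : ℤ) : ℚ)).HasAdditiveReductionAt ((primesEquiv (R := ℤ)).symm ⟨3, Nat.prime_three⟩)) →
      ∀ X₀ Y₀ : ℚ, IsShortThreeTorsion W D.c X₀ Y₀ →
      ¬ IsThreeAdicFracCube (kummerCubeSeries W 1 (X₀ / (D.c : ℚ) ^ 2) (Y₀ / (D.c : ℚ) ^ 3) X) →
      ∀ z : ℚ⟦X⟧, IsParamGerm W D.c a z →
      ∀ (r : ℕ → ℤ) (g A B : ℤ⟦X⟧), IsCuspidalKummerCubeRep N (kummerCubeSeries W D.c X₀ Y₀ z) r g A B →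
      ∃ δ ∈ N.divisors, ¬ (3 : ℤ) ∣ r δ)
    (hNB : ∀ (W : WeierstrassCurve ℚ) [W.IsElliptic] [W.IsGloballyMinimal] {N : ℕ} [NeZero N]
      (D : ModularParametrizationData W N),
      (∀ z ∈ D.L.lattice, ∃ w ∈ periodLattice D.f, z = D.c * w) → 9 ∣ N →
      ((primesEquiv (R := ℤ)).symm ⟨3, Nat.prime_three⟩).valuation ℚ W.j < 1 →
        (W.kodairaSymbolAt ((primesEquiv (R := ℤ)).symm ⟨3, Nat.prime_three⟩) = .II ∨
          W.kodairaSymbolAt ((primesEquiv (R := ℤ)).symm ⟨3, Nat.prime_three⟩) = .III ∨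
          W.kodairaSymbolAt ((primesEquiv (R := ℤ)).symm ⟨3, Nat.prime_three⟩) = .IV ∨
          W.kodairaSymbolAt ((primesEquiv (R := ℤ)).symm ⟨3, Nat.prime_three⟩) = .IVstar ∨
          W.kodairaSymbolAt ((primesEquiv (R := ℤ)).symm ⟨3, Nat.prime_three⟩) = .IIIstar ∨
          W.kodairaSymbolAt ((primesEquiv (R := ℤ)).symm ⟨3, Nat.prime_three⟩) = .IIstar) →
        (haveI := W.isElliptic_quadraticTwist (show ((-3 : ℤ) : ℚ) ≠ 0 by norm_num);
          (W.quadraticTwist ((-3 : ℤ) : ℚ)).HasAdditiveReductionAt ((primesEquiv (R := ℤ)).symm ⟨3, Nat.prime_three⟩)) →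
      ∀ X₁ Y₁ : ℚ, IsShortThreeTorsion W 1 X₁ Y₁ → ¬ IsThreeAdicFracCube (kummerCubeSeries W 1 X₁ Y₁ X))
    (hRes : ∀ (W : WeierstrassCurve ℚ) [W.IsElliptic] [W.IsGloballyMinimal] {N : ℕ} [NeZero N]
      (D : ModularParametrizationData W N),
      (∀ z ∈ D.L.lattice, ∃ w ∈ periodLattice D.f, z = D.c * w) → 3 ^ 2 ∣ N →
      ((primesEquiv (R := ℤ)).symm ⟨3, Nat.prime_three⟩).valuation ℚ W.j < 1 →
        (W.kodairaSymbolAt ((primesEquiv (R := ℤ)).symm ⟨3, Nat.prime_three⟩) = .II ∨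
          W.kodairaSymbolAt ((primesEquiv (R := ℤ)).symm ⟨3, Nat.prime_three⟩) = .III ∨
          W.kodairaSymbolAt ((primesEquiv (R := ℤ)).symm ⟨3, Nat.prime_three⟩) = .IV ∨
          W.kodairaSymbolAt ((primesEquiv (R := ℤ)).symm ⟨3, Nat.prime_three⟩) = .IVstar ∨
          W.kodairaSymbolAt ((primesEquiv (R := ℤ)).symm ⟨3, Nat.prime_three⟩) = .IIIstar ∨
          W.kodairaSymbolAt ((primesEquiv (R := ℤ)).symm ⟨3, Nat.prime_three⟩) = .IIstar) →
        (haveI := W.isElliptic_quadraticTwist (show ((-3 : ℤ) : ℚ) ≠ 0 by norm_num);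
          (W.quadraticTwist ((-3 : ℤ) : ℚ)).HasAdditiveReductionAt ((primesEquiv (R := ℤ)).symm ⟨3, Nat.prime_three⟩)) →
      ¬ W.HasIrreducibleModPGaloisRep 3 → (∀ X₀ Y₀ : ℚ, ¬ IsShortThreeTorsion W D.c X₀ Y₀) → ¬ (3 : ℤ) ∣ D.c) :
    Summit.BirchSwinnertonDyer.BirchSwinnertonDyer.Theses.ManinLocalTwoThree.ManinPrimeToThreeAtNine := by
  refine maninPrimeToThreeAtNine_of_core fun _hM _hAU _hC2 _hnf W _ _ N _ D hopt h9 hss hkod htw ↦ ?_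
  have h9' : 9 ∣ N := by norm_num at h9; exact h9
  exact not_three_dvd_maninConstant_of_datumLaws₃_kp hKP hex W D hopt h9
    (fun a ha => h57 W D a ha h9' hopt hss hkod htw) (fun a ha => hLaw W D a ha h9' hopt hss hkod htw)
    (hNB W D hopt h9' hss hkod htw) (hRes W D hopt h9 hss hkod htw)

end Summit.BirchSwinnertonDyer.BirchSwinnertonDyer.Theorems.ManinLocalTwoThree

end
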